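import Literature.NumberTheory.EllipticCurves.EisensteinNumberDistribution
import Literature.NumberTheory.EllipticCurves.LatticeJInvariant
import Mathlib.Analysis.Calculus.LogDeriv
import HarnessLib

/-!
# The elliptic function `Θ(z; L, L')` of Coates–Wiles and Rubin, and its logarithmic derivative

Topic `Literature/NumberTheory/EllipticCurves` (complex-lattice cluster); deliberate dot-notation
extensions of Mathlib's `PeriodPair`, continuing `EisensteinNumberDistribution.lean`.

Let `Λ ⊆ Λ'` be lattices (period pairs `L`, `L'`), `S ∋ 0` a system of representatives of `Λ'/Λ`
(`x ∈ Λ' ↔ ∃ c ∈ S, x − c ∈ Λ`, distinct classes; `N = #S = [Λ' : Λ]`). Rubin (LNM 1716, §7.4,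
following Coates–Wiles [CW1] and Robert) attaches to an ideal `𝔞 = (α)` of `𝒪 = 𝒪_K` and the
lattice `L = Ω𝒪` of a CM elliptic curve the elliptic function

  `Θ_{L,𝔞}(z) = α⁻¹² Δ(L)^{N𝔞−1} ∏_{u ∈ 𝔞⁻¹L/L, u ≠ 0} (℘(z; L) − ℘(u; L))⁻⁶`

(`= Θ_{E,𝔞} ∘ ξ`, Def. 7.1 and §7.4, p. 244), and proves

  **Theorem 7.13** (`k = 1`). `(d/dz) log Θ_{L,𝔞}(z) = 12 (N𝔞 · E₁(z; L) − E₁(z; 𝔞⁻¹L))`.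

Here we define, for any finite `S ⊂ ℂ` (meant: representatives of `Λ'/Λ` containing `0`),

* `PeriodPair.ellipticTheta L S z = Δ(L)^{#S − 1} ∏_{c ∈ S, c ≠ 0} (℘(z; L) − ℘(c; L))⁻⁶`,
  `Δ(L) = g₂³ − 27g₃²` — Rubin's `Θ_{L,𝔞}` without the unit factor `α⁻¹²` (which does not affect
  the logarithmic derivative; for `Λ' = 𝔞⁻¹L` the nonzero classes `u` are the `c ≠ 0`),

and prove Theorem 7.13 at `k = 1` for an arbitrary inclusion of lattices, and the analytic form of
Theorem 7.17 at `k = 1` (the logarithmic derivative at `0` of the Coates–Wiles product of translates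
`Λ(z) = ∏_{t ∈ T} Θ(t + z)`, `PeriodPair.cwProduct`):

* `PeriodPair.logDeriv_ellipticTheta` — for `z ∉ Λ'`,
  `logDeriv (Θ(·; L, S)) z = 12 (N · E₁(z; Λ) − E₁(z; Λ'))`, with `E₁ = PeriodPair.eisensteinE₁`
  (`= ζ − η`, Rubin Prop. 7.12 at `k = 1`); also in `HasDerivAt` form
  (`PeriodPair.hasDerivAt_ellipticTheta`);
* `PeriodPair.logDeriv_cwProduct_zero_eq` — for `π ≠ 0` with `πΛ ⊆ Λ`, `Λ' = π⁻¹Λ`, and a finite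
  `T ⊂ ℂ ∖ Λ'` permuted by multiplication by `π` modulo `Λ`:
  `(d/dz) log ∏_{t ∈ T} Θ(t + z; L, S)|_{z=0} = 12 (N − π) Σ_{t ∈ T} E₁(t; Λ)` (Rubin Thm. 7.17,
  `k = 1`, with `E₁(z; π⁻¹Λ) = πE₁(πz; Λ)`; the identification of `Σ_t E₁(t; Λ)` with
  `u⁻¹L_𝔣(ψ̄, 1)` is Prop. 7.15, available lattice by lattice in `BinaryLatticeKroneckerLimit` and
  `QuadraticOrderEisensteinNumbers`).

Proof (instead of Rubin's Lemma 7.10 via the non-holomorphic `θ(z; L) = Δ e^{−6η(z;L)z} σ¹²`):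
the logarithmic derivative of the product is `−6 Σ_{c ≠ 0} ℘′(z)/(℘(z) − ℘(c))`; by the `ζ`
addition formula in the form `ζ(z + c) + ζ(z − c) − 2ζ(z) = ℘′(z)/(℘(z) − ℘(c))`
(Armitage–Eberlein (7.64), the tree's `PeriodPair.weierstrassZeta_add_add_sub`) and the
`ℝ`-linearity of `η` this is `−6 Σ_{c ≠ 0} (E₁(z + c; Λ) + E₁(z − c; Λ) − 2E₁(z; Λ))`, and the
distribution relation `Σ_{c ∈ S} E₁(z ± c; Λ) = E₁(z; Λ')`
(`PeriodPair.sum_eisensteinE₁_add_eq`, `…_sub_eq`) turns it into `12(N E₁(z; Λ) − E₁(z; Λ'))`.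

## References

* K. Rubin, *Elliptic curves with complex multiplication and the conjecture of Birch and
  Swinnerton-Dyer*, in: Arithmetic Theory of Elliptic Curves (Cetraro 1997), LNM 1716, Springer
  1999: Def. 7.1, §7.4 (definition of `Θ_{L,𝔞}`, p. 244), Prop. 7.12, Thm. 7.13 (held:
  `book:coates1999-arithmetic-theory-elliptic-curves`). [Rubin1999]
* J. Coates, A. Wiles, *On the conjecture of Birch and Swinnerton-Dyer*, Invent. Math. 39 (1977),
  §4 (the elliptic units attached to `𝔞`). [CoatesWiles1977]
* E. de Shalit, *Iwasawa Theory of Elliptic Curves with Complex Multiplication*, Academic Press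
  1987, II.2. [deShalit1987]
* J. V. Armitage, W. F. Eberlein, *Elliptic Functions*, CUP 2006, §7.4.2 eq. (7.64).
  [ArmitageEberlein2001]
-/

noncomputable section

open Complex Set Filter Topology

namespace PeriodPair

variable {L L' : PeriodPair}

/-! ### The function `Θ(z; L, S)` -/

/-- **Rubin's elliptic function `Θ_{L,𝔞}` (Coates–Wiles), for a general inclusion of lattices.**
For a period pair `L` and a finite set `S ⊂ ℂ` (a system of representatives of `Λ'/Λ` containing
`0`, for a lattice `Λ' ⊇ Λ` of index `N = #S`),

  `Θ(z; L, S) = Δ(L)^{#S − 1} · ∏_{c ∈ S, c ≠ 0} (℘(z; L) − ℘(c; L))⁻⁶`,  `Δ(L) = g₂³ − 27 g₃²`.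

For `L = Ω𝒪`, `Λ' = 𝔞⁻¹L` this is `α¹² Θ_{L,𝔞}(z)` in the notation of Rubin, LNM 1716, §7.4
(`Θ_{L,𝔞}(z) = α⁻¹² Δ(L)^{N𝔞−1} ∏_{u ∈ 𝔞⁻¹L/L, u ≠ 0} (℘(z;L) − ℘(u;L))⁻⁶`, `𝔞 = (α)`); the
unit `α⁻¹²` is omitted here (it depends on the CM structure, not on the lattices, and does not
affect logarithmic derivatives). A deliberate dot-notation extension of Mathlib's `PeriodPair`.
[cite: Rubin1999, Def. 7.1 and §7.4 (p. 244)] -/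
def ellipticTheta (L : PeriodPair) (S : Finset ℂ) (z : ℂ) : ℂ :=
  (L.g₂ ^ 3 - 27 * L.g₃ ^ 2) ^ (S.card - 1) * ∏ c ∈ S.erase 0, (℘[L] z - ℘[L] c) ^ (-6 : ℤ)

/-- Unfolding lemma for `ellipticTheta`. [cite: Rubin1999, §7.4 (p. 244)] -/
theorem ellipticTheta_def (L : PeriodPair) (S : Finset ℂ) (z : ℂ) :
    L.ellipticTheta S z =
      (L.g₂ ^ 3 - 27 * L.g₃ ^ 2) ^ (S.card - 1) *
        ∏ c ∈ S.erase 0, (℘[L] z - ℘[L] c) ^ (-6 : ℤ) := rfl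

/-- `Θ(·; L, S)` is `Λ`-periodic (it is a rational function of `℘(·; L)`). [cite: Rubin1999, Lemma 7.5] -/
theorem ellipticTheta_add_coe (L : PeriodPair) (S : Finset ℂ) (z : ℂ) (ω : L.lattice) :
    L.ellipticTheta S (z + ω) = L.ellipticTheta S z := by
  simp only [ellipticTheta_def, L.weierstrassP_add_coe]

/-- `Θ(·; L, S)` is even. [cite: Rubin1999, Lemma 7.5] -/
theorem ellipticTheta_neg (L : PeriodPair) (S : Finset ℂ) (z : ℂ) :
    L.ellipticTheta S (-z) = L.ellipticTheta S z := by
  simp only [ellipticTheta_def, L.weierstrassP_neg]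

/-! ### Non-vanishing off `Λ'` -/

section Reps

variable {S : Finset ℂ}

/-- A nonzero representative is not in `Λ` (its class is not the class of `0 ∈ S`). [folklore] -/
theorem notMem_lattice_of_mem_erase (hS0 : (0 : ℂ) ∈ S)
    (hSd : ∀ c ∈ S, ∀ c' ∈ S, c - c' ∈ L.lattice → c = c') {c : ℂ} (hc : c ∈ S.erase 0) :
    c ∉ L.lattice := by
  obtain ⟨hc0, hcS⟩ := Finset.mem_erase.mp hc
  intro h
  exact hc0 (hSd c hcS 0 hS0 (by simpa using h))

/-- For `z ∉ Λ'` and a nonzero representative `c`: `℘(z; Λ) ≠ ℘(c; Λ)` (i.e. `z ≢ ±c (mod Λ)`).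
[folklore] -/
theorem weierstrassP_ne_of_reps (hS : ∀ x, x ∈ L'.lattice ↔ ∃ c ∈ S, x - c ∈ L.lattice)
    (hS0 : (0 : ℂ) ∈ S) (hSd : ∀ c ∈ S, ∀ c' ∈ S, c - c' ∈ L.lattice → c = c') {z c : ℂ}
    (hz : z ∉ L'.lattice) (hc : c ∈ S.erase 0) : ℘[L] z ≠ ℘[L] c := by
  have hle : L.lattice ≤ L'.lattice := le_of_reps hS hS0
  have hcS : c ∈ S := (Finset.mem_erase.mp hc).2
  have hzL : z ∉ L.lattice := fun h ↦ hz (hle h)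
  have hcL : c ∉ L.lattice := notMem_lattice_of_mem_erase hS0 hSd hc
  intro h
  rcases (L.weierstrassP_eq_weierstrassP_iff hzL hcL).mp h with h' | h'
  · apply hz
    have : z = (z + c) - c := by ring
    rw [this]
    exact sub_mem (hle h') (mem_of_mem_reps hS hcS)
  · exact sub_notMem_of_notMem_of_reps hS hz hcS h'

/-- **`Θ(z; L, S) ≠ 0` for `z ∉ Λ'`** (`Δ(L) ≠ 0` and no factor vanishes). [cite: Rubin1999, Lemma 7.5] -/
theorem ellipticTheta_ne_zero (hS : ∀ x, x ∈ L'.lattice ↔ ∃ c ∈ S, x - c ∈ L.lattice)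
    (hS0 : (0 : ℂ) ∈ S) (hSd : ∀ c ∈ S, ∀ c' ∈ S, c - c' ∈ L.lattice → c = c') {z : ℂ}
    (hz : z ∉ L'.lattice) : L.ellipticTheta S z ≠ 0 := by
  rw [ellipticTheta_def]
  refine mul_ne_zero (pow_ne_zero _ L.discr_ne_zero) ?_
  refine Finset.prod_ne_zero_iff.mpr fun c hc ↦ ?_
  exact zpow_ne_zero _ (sub_ne_zero.mpr (weierstrassP_ne_of_reps hS hS0 hSd hz hc))

/-! ### The logarithmic derivative (Rubin, Thm. 7.13 at `k = 1`) -/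

/-- `℘` has derivative `℘′` off the lattice (Mathlib's `deriv_weierstrassP`, in `HasDerivAt` form).
[folklore] -/
theorem hasDerivAt_weierstrassP_of_notMem (L : PeriodPair) {z : ℂ} (hz : z ∉ L.lattice) :
    HasDerivAt ℘[L] (℘'[L] z) z := by
  have hU : IsOpen (L.lattice : Set ℂ)ᶜ := L.isClosed_lattice.isOpen_compl
  have hd := (L.differentiableOn_weierstrassP.differentiableAt (hU.mem_nhds hz)).hasDerivAt
  simpa using hd

/-- **The logarithmic derivative of `Θ` as a sum over the nonzero classes**: for `z ∉ Λ'`,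
`Θ′/Θ (z) = −6 Σ_{c ∈ S, c ≠ 0} ℘′(z; Λ)/(℘(z; Λ) − ℘(c; Λ))`. [cite: Rubin1999, §7.4 Thm. 7.13 (proof)] -/
theorem logDeriv_ellipticTheta_eq_sum (hS : ∀ x, x ∈ L'.lattice ↔ ∃ c ∈ S, x - c ∈ L.lattice)
    (hS0 : (0 : ℂ) ∈ S) (hSd : ∀ c ∈ S, ∀ c' ∈ S, c - c' ∈ L.lattice → c = c') {z : ℂ}
    (hz : z ∉ L'.lattice) :
    logDeriv (L.ellipticTheta S) z =
      -6 * ∑ c ∈ S.erase 0, ℘'[L] z / (℘[L] z - ℘[L] c) := by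
  have hle : L.lattice ≤ L'.lattice := le_of_reps hS hS0
  have hzL : z ∉ L.lattice := fun h ↦ hz (hle h)
  have h℘ : HasDerivAt ℘[L] (℘'[L] z) z := L.hasDerivAt_weierstrassP_of_notMem hzL
  have hne : ∀ c ∈ S.erase 0, ℘[L] z - ℘[L] c ≠ 0 := fun c hc ↦
    sub_ne_zero.mpr (weierstrassP_ne_of_reps hS hS0 hSd hz hc)
  have hdiff : ∀ c ∈ S.erase 0, DifferentiableAt ℂ (fun w ↦ ℘[L] w - ℘[L] c) z := fun c _ ↦
    (h℘.sub_const _).differentiableAt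
  have hΘ : L.ellipticTheta S = fun w ↦ (L.g₂ ^ 3 - 27 * L.g₃ ^ 2) ^ (S.card - 1) *
      ∏ c ∈ S.erase 0, (℘[L] w - ℘[L] c) ^ (-6 : ℤ) := rfl
  rw [hΘ, logDeriv_const_mul _ _ (pow_ne_zero _ L.discr_ne_zero)]
  rw [logDeriv_prod (f := fun c w ↦ (℘[L] w - ℘[L] c) ^ (-6 : ℤ))
    (fun c hc ↦ zpow_ne_zero _ (hne c hc))
    (fun c hc ↦ (hdiff c hc).zpow (Or.inl (hne c hc)))]
  rw [Finset.mul_sum]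
  refine Finset.sum_congr rfl fun c hc ↦ ?_
  rw [logDeriv_fun_zpow (hdiff c hc), logDeriv_apply, (h℘.sub_const (℘[L] c)).deriv]
  push_cast
  ring

/-- **Rubin, LNM 1716, Theorem 7.13 for `k = 1` (logarithmic derivative of `Θ`).** Let `Λ ⊆ Λ'` be
lattices and `S ∋ 0` a system of representatives of `Λ'/Λ`, `N = #S`. Then for every `z ∉ Λ'`,

  `(d/dz) log Θ(z; L, S) = 12 (N · E₁(z; Λ) − E₁(z; Λ'))`,

with `E₁(z; L) = ζ(z; L) − η(z; L)` (`PeriodPair.eisensteinE₁`, Rubin Prop. 7.12 at `k = 1`). For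
`L = Ω𝒪`, `Λ' = 𝔞⁻¹L` this is `(d/dz) log Θ_{L,𝔞}(z) = 12(N𝔞 E₁(z; L) − E₁(z; 𝔞⁻¹L))` as
printed (the omitted constant `α⁻¹²` has logarithmic derivative `0`). Proof: the sum formula
`logDeriv_ellipticTheta_eq_sum`, the `ζ` addition formula
`ζ(z + c) + ζ(z − c) − 2ζ(z) = ℘′(z)/(℘(z) − ℘(c))` (`PeriodPair.weierstrassZeta_add_add_sub`),
`ℝ`-linearity of `η`, and the distribution relation of `E₁`
(`PeriodPair.sum_eisensteinE₁_add_eq`, `PeriodPair.sum_eisensteinE₁_sub_eq`).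
[cite: Rubin1999, §7.4 Thm. 7.13] -/
theorem logDeriv_ellipticTheta (hS : ∀ x, x ∈ L'.lattice ↔ ∃ c ∈ S, x - c ∈ L.lattice)
    (hS0 : (0 : ℂ) ∈ S) (hSd : ∀ c ∈ S, ∀ c' ∈ S, c - c' ∈ L.lattice → c = c') {z : ℂ}
    (hz : z ∉ L'.lattice) :
    logDeriv (L.ellipticTheta S) z =
      12 * ((S.card : ℂ) * L.eisensteinE₁ z - L'.eisensteinE₁ z) := by
  have hle : L.lattice ≤ L'.lattice := le_of_reps hS hS0
  have hzL : z ∉ L.lattice := fun h ↦ hz (hle h)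
  rw [logDeriv_ellipticTheta_eq_sum hS hS0 hSd hz]
  -- each term via the `ζ` addition formula, rewritten with `E₁`
  have hterm : ∀ c ∈ S.erase 0, ℘'[L] z / (℘[L] z - ℘[L] c) =
      L.eisensteinE₁ (z + c) + L.eisensteinE₁ (z - c) - 2 * L.eisensteinE₁ z := by
    intro c hc
    have hcL : c ∉ L.lattice := notMem_lattice_of_mem_erase hS0 hSd hc
    have hne : ℘[L] z ≠ ℘[L] c := weierstrassP_ne_of_reps hS hS0 hSd hz hc
    rw [← weierstrassZeta_add_add_sub L.weierstrassZeta_add_holds hzL hcL hne]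
    simp only [eisensteinE₁_def, map_add, map_sub]
    ring
  rw [Finset.sum_congr rfl hterm, Finset.sum_sub_distrib, Finset.sum_add_distrib,
    Finset.sum_const, nsmul_eq_mul]
  -- put back the `c = 0` terms and apply the distribution relation in both forms
  have hadd : ∑ c ∈ S.erase 0, L.eisensteinE₁ (z + c) = L'.eisensteinE₁ z - L.eisensteinE₁ z := by
    have h := Finset.add_sum_erase S (fun c ↦ L.eisensteinE₁ (z + c)) hS0
    rw [sum_eisensteinE₁_add_eq hS hS0 hSd hz, add_zero] at h
    linear_combination h
  have hsub : ∑ c ∈ S.erase 0, L.eisensteinE₁ (z - c) = L'.eisensteinE₁ z - L.eisensteinE₁ z := by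
    have h := Finset.add_sum_erase S (fun c ↦ L.eisensteinE₁ (z - c)) hS0
    rw [sum_eisensteinE₁_sub_eq hS hS0 hSd hz, sub_zero] at h
    linear_combination h
  rw [hadd, hsub, Finset.card_erase_of_mem hS0]
  have hcard : 1 ≤ S.card := Finset.card_pos.mpr ⟨0, hS0⟩
  push_cast [Nat.cast_sub hcard]
  ring

/-- `Θ(·; L, S)` is differentiable at every `z ∉ Λ'`. [cite: Rubin1999, Lemma 7.5] -/
theorem differentiableAt_ellipticTheta (hS : ∀ x, x ∈ L'.lattice ↔ ∃ c ∈ S, x - c ∈ L.lattice)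
    (hS0 : (0 : ℂ) ∈ S) (hSd : ∀ c ∈ S, ∀ c' ∈ S, c - c' ∈ L.lattice → c = c') {z : ℂ}
    (hz : z ∉ L'.lattice) : DifferentiableAt ℂ (L.ellipticTheta S) z := by
  have hle : L.lattice ≤ L'.lattice := le_of_reps hS hS0
  have hzL : z ∉ L.lattice := fun h ↦ hz (hle h)
  have h℘ : HasDerivAt ℘[L] (℘'[L] z) z := L.hasDerivAt_weierstrassP_of_notMem hzL
  have hΘ : L.ellipticTheta S = fun w ↦ (L.g₂ ^ 3 - 27 * L.g₃ ^ 2) ^ (S.card - 1) *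
      ∏ c ∈ S.erase 0, (℘[L] w - ℘[L] c) ^ (-6 : ℤ) := rfl
  rw [hΘ]
  refine (DifferentiableAt.fun_finsetProd fun c hc ↦ ?_).const_mul _
  exact (h℘.sub_const _).differentiableAt.zpow
    (Or.inl (sub_ne_zero.mpr (weierstrassP_ne_of_reps hS hS0 hSd hz hc)))

/-- **Theorem 7.13 (`k = 1`) in `HasDerivAt` form**: for `z ∉ Λ'`,
`Θ′(z) = Θ(z) · 12 (N E₁(z; Λ) − E₁(z; Λ'))`. [cite: Rubin1999, §7.4 Thm. 7.13] -/
theorem hasDerivAt_ellipticTheta (hS : ∀ x, x ∈ L'.lattice ↔ ∃ c ∈ S, x - c ∈ L.lattice)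
    (hS0 : (0 : ℂ) ∈ S) (hSd : ∀ c ∈ S, ∀ c' ∈ S, c - c' ∈ L.lattice → c = c') {z : ℂ}
    (hz : z ∉ L'.lattice) :
    HasDerivAt (L.ellipticTheta S)
      (L.ellipticTheta S z * (12 * ((S.card : ℂ) * L.eisensteinE₁ z - L'.eisensteinE₁ z))) z := by
  have hd := (differentiableAt_ellipticTheta hS hS0 hSd hz).hasDerivAt
  have hne := ellipticTheta_ne_zero hS hS0 hSd hz
  have hlog := logDeriv_ellipticTheta hS hS0 hSd hz
  rw [logDeriv_apply, div_eq_iff hne] at hlog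
  rwa [hlog, mul_comm] at hd

end Reps

/-! ### The Coates–Wiles product `Λ(z) = ∏_{t ∈ T} Θ(t + z)` and Rubin's Thm. 7.17 at `k = 1` -/

section CWProduct

variable {S T : Finset ℂ}

/-- **The Coates–Wiles product of translates of `Θ`** (Rubin, LNM 1716, §7.3 and Def. 7.16:
`Λ_{L,𝔞}(z) = ∏_{𝔟 ∈ B} Θ_{L,𝔞}(ψ(𝔟)u + z)`, `u = Ω/f`): for a finite set `T ⊂ ℂ` of translation
points, `Λ(z; L, S, T) = ∏_{t ∈ T} Θ(t + z; L, S)`. In Rubin's setting `T = {ψ(𝔟)u : 𝔟 ∈ B}`.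
[cite: Rubin1999, Def. 7.16] -/
def cwProduct (L : PeriodPair) (S T : Finset ℂ) (z : ℂ) : ℂ := ∏ t ∈ T, L.ellipticTheta S (t + z)

/-- Unfolding lemma for `cwProduct`. [cite: Rubin1999, Def. 7.16] -/
theorem cwProduct_def (L : PeriodPair) (S T : Finset ℂ) (z : ℂ) :
    L.cwProduct S T z = ∏ t ∈ T, L.ellipticTheta S (t + z) := rfl

/-- **The logarithmic derivative of the product at `0` is the sum of the logarithmic derivatives of
`Θ` at the translation points** (the first line of the proof of Rubin's Thm. 7.17), provided no
`t ∈ T` lies in `Λ'`. [cite: Rubin1999, Thm. 7.17 (proof)] -/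
theorem logDeriv_cwProduct_zero (hS : ∀ x, x ∈ L'.lattice ↔ ∃ c ∈ S, x - c ∈ L.lattice)
    (hS0 : (0 : ℂ) ∈ S) (hSd : ∀ c ∈ S, ∀ c' ∈ S, c - c' ∈ L.lattice → c = c')
    (hT : ∀ t ∈ T, t ∉ L'.lattice) :
    logDeriv (L.cwProduct S T) 0 = ∑ t ∈ T, logDeriv (L.ellipticTheta S) t := by
  have hΛ : L.cwProduct S T = fun z ↦ ∏ t ∈ T, L.ellipticTheta S (t + z) := rfl
  rw [hΛ, logDeriv_prod (f := fun t z ↦ L.ellipticTheta S (t + z))]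
  · refine Finset.sum_congr rfl fun t ht ↦ ?_
    have hd : DifferentiableAt ℂ (L.ellipticTheta S) (t + 0) := by
      rw [add_zero]; exact differentiableAt_ellipticTheta hS hS0 hSd (hT t ht)
    rw [show (fun z ↦ L.ellipticTheta S (t + z)) = L.ellipticTheta S ∘ (fun z ↦ t + z) from rfl,
      logDeriv_comp hd (differentiableAt_id.const_add t)]
    simp
  · intro t ht
    simpa using ellipticTheta_ne_zero hS hS0 hSd (hT t ht)
  · intro t ht
    have hd : DifferentiableAt ℂ (L.ellipticTheta S) (t + 0) := by
      rw [add_zero]; exact differentiableAt_ellipticTheta hS hS0 hSd (hT t ht)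
    exact hd.comp 0 (differentiableAt_id.const_add t)

/-- **Multiplication by `π` permutes the translation points modulo `Λ` ⇒ the class sum of
`E₁(·; Λ)` is invariant**: if for every `t ∈ T` there is `t' ∈ T` with `πt ≡ t' (mod Λ)`, and
`πt₁ ≡ πt₂ (mod Λ)` forces `t₁ = t₂` on `T`, then `Σ_{t ∈ T} E₁(πt; Λ) = Σ_{t ∈ T} E₁(t; Λ)` (Rubin,
proof of Thm. 7.17: `𝔟 ↦ 𝔞𝔟` permutes `B` modulo the conductor). [cite: Rubin1999, Thm. 7.17 (proof)] -/
theorem sum_eisensteinE₁_mul_eq (L : PeriodPair) {π : ℂ}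
    (hperm : ∀ t ∈ T, ∃ t' ∈ T, π * t - t' ∈ L.lattice)
    (hinj : ∀ t₁ ∈ T, ∀ t₂ ∈ T, π * t₁ - π * t₂ ∈ L.lattice → t₁ = t₂) :
    ∑ t ∈ T, L.eisensteinE₁ (π * t) = ∑ t ∈ T, L.eisensteinE₁ t := by
  classical
  -- the map `t ↦ t'` is injective on `T`, hence a bijection of `T`
  set i : ℂ → ℂ := fun t ↦ if h : t ∈ T then Classical.choose (hperm t h) else t with hi
  have hi_mem : ∀ t ∈ T, i t ∈ T := by
    intro t ht
    simp only [hi, dif_pos ht]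
    exact (Classical.choose_spec (hperm t ht)).1
  have hi_sub : ∀ t ∈ T, π * t - i t ∈ L.lattice := by
    intro t ht
    simp only [hi, dif_pos ht]
    exact (Classical.choose_spec (hperm t ht)).2
  have hi_inj : Set.InjOn i T := by
    intro t₁ ht₁ t₂ ht₂ heq
    refine hinj t₁ ht₁ t₂ ht₂ ?_
    have e : π * t₁ - π * t₂ = (π * t₁ - i t₁) - (π * t₂ - i t₂) := by rw [heq]; ring
    rw [e]
    exact sub_mem (hi_sub t₁ ht₁) (hi_sub t₂ ht₂)
  have hi_surj : Set.SurjOn i T T := by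
    intro t ht
    have := Finset.surj_on_of_inj_on_of_card_le (s := T) (t := T) (fun a _ ↦ i a)
      (fun a ha ↦ hi_mem a ha) (fun a₁ a₂ ha₁ ha₂ h ↦ hi_inj ha₁ ha₂ h) le_rfl t ht
    obtain ⟨a, ha, rfl⟩ := this
    exact ⟨a, ha, rfl⟩
  calc ∑ t ∈ T, L.eisensteinE₁ (π * t) = ∑ t ∈ T, L.eisensteinE₁ (i t) := by
        refine Finset.sum_congr rfl fun t ht ↦ ?_
        have e : π * t = i t + (π * t - i t) := by ring
        rw [e, L.eisensteinE₁_add_of_mem_lattice (hi_sub t ht)]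
    _ = ∑ t ∈ T, L.eisensteinE₁ t := Finset.sum_nbij i hi_mem hi_inj hi_surj fun _ _ ↦ rfl

/-- **Rubin, LNM 1716, Theorem 7.17 for `k = 1`, analytic form.** Let `Λ` be a lattice, `π ≠ 0`
with `πΛ ⊆ Λ`, `Λ' = π⁻¹Λ ⊇ Λ` with a system of representatives `S ∋ 0` (`N = #S = [π⁻¹Λ : Λ]`),
and `T` a finite set of points off `Λ'` which multiplication by `π` permutes modulo `Λ`. Then the
logarithmic derivative at `z = 0` of `Λ(z) = ∏_{t ∈ T} Θ(t + z; L, S)` is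

  `(d/dz) log Λ(z)|_{z=0} = 12 (N − π) Σ_{t ∈ T} E₁(t; Λ)`.

In Rubin's setting (`L = Ω𝒪`, `𝔞 = (π)` with `π = ψ(𝔞)`, `Λ' = 𝔞⁻¹L`, `N = N𝔞`,
`T = {ψ(𝔟)u : 𝔟 ∈ B}`, `u = Ω/f`) this is his computation
`Σ_𝔟 (d/dz)log Θ_{L,𝔞}(z)|_{z=ψ(𝔟)u} = 12(N𝔞 Σ_𝔟 E₁(ψ(𝔟)u; L) − Σ_𝔟 E₁(ψ(𝔟)u; 𝔞⁻¹L))` with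
`E₁(z; 𝔞⁻¹L) = ψ(𝔞)E₁(ψ(𝔞)z; L)` and `𝔟 ↦ 𝔞𝔟` permuting `B`; the remaining identification
`Σ_𝔟 E₁(ψ(𝔟)u; L) = u⁻¹ L_𝔣(ψ̄, 1)` (his Prop. 7.15) is supplied, lattice by lattice, by
`BinaryLatticeKroneckerLimit.thetaLFunction_one_eq_sum_eisensteinE₁` and
`QuadraticOrderEisensteinNumbers.thetaLFunction_parityLift_one`.
[cite: Rubin1999, Thm. 7.17 (LNM 1716 p. 245)] -/
theorem logDeriv_cwProduct_zero_eq (L : PeriodPair) {π : ℂ} (hπ : π ≠ 0)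
    (hS : ∀ x, x ∈ (L.mulLeft π⁻¹ (inv_ne_zero hπ)).lattice ↔ ∃ c ∈ S, x - c ∈ L.lattice)
    (hS0 : (0 : ℂ) ∈ S) (hSd : ∀ c ∈ S, ∀ c' ∈ S, c - c' ∈ L.lattice → c = c')
    (hT : ∀ t ∈ T, t ∉ (L.mulLeft π⁻¹ (inv_ne_zero hπ)).lattice)
    (hperm : ∀ t ∈ T, ∃ t' ∈ T, π * t - t' ∈ L.lattice)
    (hinj : ∀ t₁ ∈ T, ∀ t₂ ∈ T, π * t₁ - π * t₂ ∈ L.lattice → t₁ = t₂) :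
    logDeriv (L.cwProduct S T) 0 = 12 * ((S.card : ℂ) - π) * ∑ t ∈ T, L.eisensteinE₁ t := by
  rw [logDeriv_cwProduct_zero hS hS0 hSd hT]
  have hterm : ∀ t ∈ T, logDeriv (L.ellipticTheta S) t =
      12 * ((S.card : ℂ) * L.eisensteinE₁ t - π * L.eisensteinE₁ (π * t)) := by
    intro t ht
    rw [logDeriv_ellipticTheta hS hS0 hSd (hT t ht), L.eisensteinE₁_mulLeft' (inv_ne_zero hπ),
      inv_inv, div_inv_eq_mul, mul_comm t π]
  rw [Finset.sum_congr rfl hterm, ← Finset.mul_sum, Finset.sum_sub_distrib, ← Finset.mul_sum,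
    ← Finset.mul_sum, L.sum_eisensteinE₁_mul_eq hperm hinj]
  ring

end CWProduct

end PeriodPair

end
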